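import Literature.NumberTheory.LFunctions.KloostermanIncompleteSplit
import Literature.NumberTheory.LFunctions.TrilinearKloostermanFractionsTwistedIncomplete
import HarnessLib

/-!
# Trilinear forms with Kloosterman fractions: the phases on the diagonal (Bettin–Chandee §3, general `A`)

Topic `NumberTheory/LFunctions`.  S. Bettin, V. Chandee, *Trilinear forms with Kloosterman
fractions*, Adv. Math. 328 (2018), §3 "The diagonal terms": for `ℓ₁n₁ = ℓ₂n₂` the product of the
two phases of `𝒟_b` is a single Kloosterman fraction,
"`e(ϑa₁ℓ₁m̄/(bℓ₁n₁) − ϑa₂ℓ₂m̄/(bℓ₂n₂)) = e(ϑ(a₁ℓ₁ − a₂ℓ₂)m̄/(bℓ₁n₁))`" (second display of §3),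
and the `m`-sum is an incomplete Kloosterman sum to modulus `bℓ₁n₁`, bounded by "the version of
Weil's bound given in Lemma 1"; with the twist of Remark 2 (`f(x,y) = ηa/(xy)`) the `m`-sum carries
the extra factor `e(θ/m)`, `θ = η(a₁ℓ₁ − a₂ℓ₂)/(bℓ₁n₁)`.  This file PROVES these identities and
the resulting bound for ONE `m`-sum, for the general-`A`, twisted coefficients
`c_m(n) = γ_n ∑_a ν_a e(ϑ a m̄^{(bn)}/(bn) + η a/(m bn))` of
`TrilinearKloostermanFractionsFrom51.lean` (the tree's `KloostermanFractionsDiagonal.lean`,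
`kfd_phase_combine`/`kfd_msum_le`, is the case `A = 1`, untwisted):

* `BC_phase_combine2` — two numerators: `e(k₁m̄^{(bn₁)}/(bn₁)) conj e(k₂m̄^{(bn₂)}/(bn₂)) = e((k₁ℓ₁ − k₂ℓ₂)m̄^{(bN₀)}/(bN₀))`
  (`N₀ = ℓ₁n₁ = ℓ₂n₂`, `(m, bN₀) = 1`);
* `BC_twist_combine` — `e(ηa₁/(m bn₁)) conj e(ηa₂/(m bn₂)) = e(θ/m)`, `θ = η(a₁ℓ₁ − a₂ℓ₂)/(bN₀)`;
* `BC_twisted_msum_le` — the natural-number form of `BC_twisted_incomplete_kloosterman_le`: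
  `‖∑_{M₁<m≤M₂,(m,s)=1} e(a m̄/s) e(θ/m)‖ ≤ (((M₂−M₁)/s)(a,s) + τ(s)√s√(a,s)(1+log s))(1 + 2π|θ|/(M₁+1))`.

No new named facts (D-0026).

## References

* S. Bettin, V. Chandee, Adv. Math. 328 (2018) 1234–1262 (arXiv:1502.00769), §3 (the two displays
  before (3.3)), Remark 2, Appendix Lemma 1. [BettinChandee2018]
-/

noncomputable section

open Finset Real

namespace Literature.NumberTheory.LFunctions

/-- `conj e(k x̄/q) = e((-k) x̄/q)` for the Kloosterman-fraction phase. [folklore] -/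
theorem BC_conj_kphase (k : ℤ) (q m : ℕ) :
    (starRingEnd ℂ) (Complex.exp (2 * Real.pi * Complex.I *
        ((k : ℂ) * ((((m : ZMod q)⁻¹).val : ℕ) : ℂ) / (q : ℂ)))) =
      Complex.exp (2 * Real.pi * Complex.I *
        (((-k : ℤ) : ℂ) * ((((m : ZMod q)⁻¹).val : ℕ) : ℂ) / (q : ℂ))) := by
  rw [← Complex.exp_conj]
  congr 1
  simp only [map_mul, map_div₀, map_ofNat, Complex.conj_ofReal, Complex.conj_I, map_intCast,
    map_natCast]
  push_cast
  ring

/-- **Combining the two Kloosterman-fraction phases on the diagonal, two numerators**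
(Bettin–Chandee §3, the display "`e(ϑa₁ℓ₁m̄/(bℓ₁n₁) − ϑa₂ℓ₂m̄/(bℓ₂n₂)) = e(ϑ(a₁ℓ₁−a₂ℓ₂)m̄/(bℓ₁n₁))`",
with `k₁ = ϑa₁`, `k₂ = ϑa₂`): for `ℓ₁n₁ = ℓ₂n₂ = N₀` and `(m, bN₀) = 1`,
`e(k₁ m̄^{(bn₁)}/(bn₁)) · conj e(k₂ m̄^{(bn₂)}/(bn₂)) = e((k₁ℓ₁ − k₂ℓ₂) m̄^{(bN₀)}/(bN₀))` (the tree's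
`kfd_phase_combine` is the case `k₁ = k₂`). [cite: BettinChandee2018, §3] -/
theorem BC_phase_combine2 (k₁ k₂ : ℤ) {b ℓ₁ n₁ ℓ₂ n₂ m : ℕ} (hb : 0 < b) (hℓ₁ : 0 < ℓ₁)
    (hn₁ : 0 < n₁) (hn₂ : 0 < n₂) (hN : ℓ₁ * n₁ = ℓ₂ * n₂) (hm : m.Coprime (b * (ℓ₁ * n₁))) :
    Complex.exp (2 * Real.pi * Complex.I *
        ((k₁ : ℂ) * ((((m : ZMod (b * n₁))⁻¹).val : ℕ) : ℂ) / ((b * n₁ : ℕ) : ℂ))) *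
      (starRingEnd ℂ) (Complex.exp (2 * Real.pi * Complex.I *
        ((k₂ : ℂ) * ((((m : ZMod (b * n₂))⁻¹).val : ℕ) : ℂ) / ((b * n₂ : ℕ) : ℂ)))) =
      Complex.exp (2 * Real.pi * Complex.I *
        (((k₁ * ℓ₁ - k₂ * ℓ₂ : ℤ) : ℂ) * ((((m : ZMod (b * (ℓ₁ * n₁)))⁻¹).val : ℕ) : ℂ) /
          ((b * (ℓ₁ * n₁) : ℕ) : ℂ))) := by
  have hs₂ : b * (ℓ₁ * n₁) = b * (ℓ₂ * n₂) := by rw [hN]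
  haveI : NeZero (b * (ℓ₁ * n₁)) := ⟨(Nat.mul_pos hb (Nat.mul_pos hℓ₁ hn₁)).ne'⟩
  haveI : NeZero (b * n₁) := ⟨(Nat.mul_pos hb hn₁).ne'⟩
  haveI : NeZero (b * n₂) := ⟨(Nat.mul_pos hb hn₂).ne'⟩
  have hd₁ : b * n₁ ∣ b * (ℓ₁ * n₁) := ⟨ℓ₁, by ring⟩
  have hd₂ : b * n₂ ∣ b * (ℓ₁ * n₁) := ⟨ℓ₂, by rw [hs₂]; ring⟩
  have h1 : ((m : ZMod (b * n₁))⁻¹).val = ((m : ZMod (b * (ℓ₁ * n₁)))⁻¹).val % (b * n₁) :=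
    (KI_inv_val_mod_nat hd₁ hm).symm
  have h2 : ((m : ZMod (b * n₂))⁻¹).val = ((m : ZMod (b * (ℓ₁ * n₁)))⁻¹).val % (b * n₂) :=
    (KI_inv_val_mod_nat hd₂ hm).symm
  rw [BC_conj_kphase]
  rw [h1, h2, ← KI_e_mod k₁ (Nat.mul_pos hb hn₁), ← KI_e_mod (-k₂) (Nat.mul_pos hb hn₂),
    ← Complex.exp_add]
  congr 1
  set u : ℕ := ((m : ZMod (b * (ℓ₁ * n₁)))⁻¹).val with hu
  have hℓ₂ : 0 < ℓ₂ := Nat.pos_of_ne_zero (by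
    rintro rfl; rw [zero_mul] at hN; exact (Nat.mul_pos hℓ₁ hn₁).ne' hN)
  have hb0 : (b : ℂ) ≠ 0 := by exact_mod_cast hb.ne'
  have hℓ₁0 : (ℓ₁ : ℂ) ≠ 0 := by exact_mod_cast hℓ₁.ne'
  have hℓ₂0 : (ℓ₂ : ℂ) ≠ 0 := by exact_mod_cast hℓ₂.ne'
  have hn₁0 : (n₁ : ℂ) ≠ 0 := by exact_mod_cast hn₁.ne'
  have hn₂0 : (n₂ : ℂ) ≠ 0 := by exact_mod_cast hn₂.ne'
  have e1 : ((b * n₁ : ℕ) : ℂ)⁻¹ = (ℓ₁ : ℂ) / ((b * (ℓ₁ * n₁) : ℕ) : ℂ) := by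
    push_cast; field_simp
  have e2 : ((b * n₂ : ℕ) : ℂ)⁻¹ = (ℓ₂ : ℂ) / ((b * (ℓ₁ * n₁) : ℕ) : ℂ) := by
    rw [hs₂]; push_cast; field_simp
  simp only [div_eq_mul_inv]
  rw [e1, e2]
  push_cast
  ring

/-- `conj e(x) = e(-x)` for a real phase `x` written as `η a/(m q)`. [folklore] -/
theorem BC_conj_twistPhase (η : ℝ) (a m q : ℕ) :
    (starRingEnd ℂ) (Complex.exp (2 * Real.pi * Complex.I * ((η : ℂ) * (a : ℂ) / ((m : ℂ) * (q : ℂ))))) =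
      Complex.exp (2 * Real.pi * Complex.I * (-((η : ℂ) * (a : ℂ) / ((m : ℂ) * (q : ℂ))))) := by
  rw [← Complex.exp_conj]
  congr 1
  simp only [map_mul, map_div₀, map_ofNat, Complex.conj_ofReal, Complex.conj_I, map_natCast]
  ring

/-- **Combining the two twists on the diagonal** (Remark 2's `f(x,y) = ηa/(xy)` on the diagonal):
for `ℓ₁n₁ = ℓ₂n₂ = N₀`, `b, n₁, n₂, m ≥ 1`,
`e(ηa₁/(m bn₁)) · conj e(ηa₂/(m bn₂)) = e(θ/m)` with `θ = η(a₁ℓ₁ − a₂ℓ₂)/(bN₀)`.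
[cite: BettinChandee2018, Remark 2] -/
theorem BC_twist_combine (η : ℝ) (a₁ a₂ : ℕ) {b ℓ₁ n₁ ℓ₂ n₂ m : ℕ} (hb : 0 < b) (hℓ₁ : 0 < ℓ₁)
    (hn₁ : 0 < n₁) (hn₂ : 0 < n₂) (hm : 0 < m) (hN : ℓ₁ * n₁ = ℓ₂ * n₂) :
    Complex.exp (2 * Real.pi * Complex.I * ((η : ℂ) * (a₁ : ℂ) / ((m : ℂ) * ((b * n₁ : ℕ) : ℂ)))) *
      (starRingEnd ℂ) (Complex.exp (2 * Real.pi * Complex.I *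
        ((η : ℂ) * (a₂ : ℂ) / ((m : ℂ) * ((b * n₂ : ℕ) : ℂ))))) =
      Complex.exp (2 * Real.pi * Complex.I *
        (((η * (((a₁ * ℓ₁ : ℕ) : ℝ) - ((a₂ * ℓ₂ : ℕ) : ℝ)) / ((b * (ℓ₁ * n₁) : ℕ) : ℝ) : ℝ) : ℂ) /
          (m : ℂ))) := by
  have hs₂ : ((b * (ℓ₁ * n₁) : ℕ) : ℂ) = ((b * (ℓ₂ * n₂) : ℕ) : ℂ) := by rw [hN]
  have hℓ₂ : 0 < ℓ₂ := Nat.pos_of_ne_zero (by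
    rintro rfl; rw [zero_mul] at hN; exact (Nat.mul_pos hℓ₁ hn₁).ne' hN)
  have hconj := BC_conj_twistPhase η a₂ m (b * n₂)
  rw [show (((b * n₂ : ℕ) : ℕ) : ℂ) = ((b * n₂ : ℕ) : ℂ) from rfl] at hconj
  rw [hconj, ← Complex.exp_add]
  congr 1
  have hb0 : (b : ℂ) ≠ 0 := by exact_mod_cast hb.ne'
  have hℓ₁0 : (ℓ₁ : ℂ) ≠ 0 := by exact_mod_cast hℓ₁.ne'
  have hℓ₂0 : (ℓ₂ : ℂ) ≠ 0 := by exact_mod_cast hℓ₂.ne'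
  have hn₁0 : (n₁ : ℂ) ≠ 0 := by exact_mod_cast hn₁.ne'
  have hn₂0 : (n₂ : ℂ) ≠ 0 := by exact_mod_cast hn₂.ne'
  have hm0 : (m : ℂ) ≠ 0 := by exact_mod_cast hm.ne'
  have hNC : (ℓ₁ : ℂ) * n₁ = ℓ₂ * n₂ := by exact_mod_cast hN
  -- `1/(bn₂) = ℓ₂/(bℓ₁n₁)` and `1/(bn₁) = ℓ₁/(bℓ₁n₁)`
  have e1 : (1 : ℂ) / ((b * n₁ : ℕ) : ℂ) = (ℓ₁ : ℂ) / ((b * (ℓ₁ * n₁) : ℕ) : ℂ) := by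
    push_cast; field_simp
  have e2 : (1 : ℂ) / ((b * n₂ : ℕ) : ℂ) = (ℓ₂ : ℂ) / ((b * (ℓ₁ * n₁) : ℕ) : ℂ) := by
    rw [hN]; push_cast; field_simp
  have eq1 : (η : ℂ) * (a₁ : ℂ) / ((m : ℂ) * ((b * n₁ : ℕ) : ℂ)) =
      (η : ℂ) * (a₁ : ℂ) / (m : ℂ) * ((1 : ℂ) / ((b * n₁ : ℕ) : ℂ)) := by
    have : ((b * n₁ : ℕ) : ℂ) ≠ 0 := by push_cast; exact mul_ne_zero hb0 hn₁0
    field_simp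
  have eq2 : (η : ℂ) * (a₂ : ℂ) / ((m : ℂ) * ((b * n₂ : ℕ) : ℂ)) =
      (η : ℂ) * (a₂ : ℂ) / (m : ℂ) * ((1 : ℂ) / ((b * n₂ : ℕ) : ℂ)) := by
    have : ((b * n₂ : ℕ) : ℂ) ≠ 0 := by push_cast; exact mul_ne_zero hb0 hn₂0
    field_simp
  rw [eq1, eq2, e1, e2]
  have hq0 : ((b * (ℓ₁ * n₁) : ℕ) : ℂ) ≠ 0 := by
    push_cast; exact mul_ne_zero hb0 (mul_ne_zero hℓ₁0 hn₁0)
  push_cast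
  field_simp
  ring

/-- **The twisted `m`-sum over natural numbers** (the natural-number form of
`BC_twisted_incomplete_kloosterman_le`): for `s ≥ 1`, `a ∈ ℤ`, real `θ` and `M₁ ≤ M₂`,
`‖∑_{M₁<m≤M₂,(m,s)=1} e(a m̄/s) e(θ/m)‖ ≤ (((M₂−M₁)/s)(a,s) + τ(s)√s√(a,s)(1+log s))(1 + 2π|θ|/(M₁+1))`.
[cite: BettinChandee2018, Appendix Lemma 1 and Remark 2] -/
theorem BC_twisted_msum_le {s : ℕ} (hs : 0 < s) (a : ℤ) (θ : ℝ) {M₁ M₂ : ℕ} (hM : M₁ ≤ M₂) :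
    ‖∑ m ∈ (Ioc M₁ M₂).filter (fun m => m.Coprime s),
        Complex.exp (2 * Real.pi * Complex.I *
          ((a : ℂ) * ((((m : ZMod s)⁻¹).val : ℕ) : ℂ) / (s : ℂ))) *
        Complex.exp (2 * Real.pi * Complex.I * ((θ : ℂ) / (m : ℂ)))‖ ≤
      (((M₂ : ℝ) - M₁) / s * Int.gcd a s +
        (Nat.divisors s).card * Real.sqrt s * Real.sqrt (Int.gcd a s) * (1 + Real.log s)) *
        (1 + 2 * Real.pi * |θ| / ((M₁ : ℝ) + 1)) := by
  have h := BC_twisted_incomplete_kloosterman_le hs a θ (M₁ := (M₁ : ℤ)) (M₂ := (M₂ : ℤ))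
    (by exact_mod_cast Nat.zero_le M₁) (by exact_mod_cast hM)
  have hsum : ∑ y ∈ (Finset.Ioc (M₁ : ℤ) M₂).filter (fun y : ℤ => Int.gcd y s = 1),
        Complex.exp (2 * Real.pi * Complex.I *
          ((a : ℂ) * (((((y : ℤ) : ZMod s)⁻¹).val : ℕ) : ℂ) / (s : ℂ))) *
        Complex.exp (2 * Real.pi * Complex.I * ((θ : ℂ) / (y : ℂ))) =
      ∑ m ∈ (Ioc M₁ M₂).filter (fun m => m.Coprime s),
        Complex.exp (2 * Real.pi * Complex.I *
          ((a : ℂ) * ((((m : ZMod s)⁻¹).val : ℕ) : ℂ) / (s : ℂ))) *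
        Complex.exp (2 * Real.pi * Complex.I * ((θ : ℂ) / (m : ℂ))) := by
    refine Finset.sum_nbij' (fun y => y.toNat) (fun m => (m : ℤ)) ?_ ?_ ?_ ?_ ?_
    · intro y hy
      simp only [Finset.mem_filter, Finset.mem_Ioc] at hy ⊢
      obtain ⟨⟨h1, h2⟩, h3⟩ := hy
      refine ⟨⟨by omega, by omega⟩, ?_⟩
      have hy0 : 0 ≤ y := by omega
      rw [Nat.Coprime, ← h3, Int.gcd_eq_natAbs, Int.natAbs_natCast]
      congr 1
      omega
    · intro m hm
      simp only [Finset.mem_filter, Finset.mem_Ioc] at hm ⊢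
      obtain ⟨⟨h1, h2⟩, h3⟩ := hm
      refine ⟨⟨by omega, by omega⟩, ?_⟩
      rw [Int.gcd_eq_natAbs, Int.natAbs_natCast, Int.natAbs_natCast]
      exact h3
    · intro y hy
      simp only [Finset.mem_filter, Finset.mem_Ioc] at hy
      exact Int.toNat_of_nonneg (by omega)
    · intro m _
      simp
    · intro y hy
      simp only [Finset.mem_filter, Finset.mem_Ioc] at hy
      have hy0 : 0 ≤ y := by omega
      have hc : ((y.toNat : ℕ) : ℤ) = y := Int.toNat_of_nonneg hy0
      have hz : ((y.toNat : ℕ) : ZMod s) = ((y : ℤ) : ZMod s) := by rw [← Int.cast_natCast, hc]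
      have hc' : ((y.toNat : ℕ) : ℂ) = ((y : ℤ) : ℂ) := by exact_mod_cast hc
      rw [hz, hc']
  rw [hsum] at h
  have hcast : (((M₂ : ℤ) - (M₁ : ℤ) : ℤ) : ℝ) = (M₂ : ℝ) - M₁ := by push_cast; ring
  rw [hcast] at h
  have hM1 : (((M₁ : ℤ) : ℝ)) = (M₁ : ℝ) := by push_cast; ring
  rw [hM1] at h
  exact h

end Literature.NumberTheory.LFunctions

end
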